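import Summits.NavierStokesRegularity.NavierStokesRegularity.Theses.ContinuousAlignment
import Literature.Analysis.FluidPDE.LerayProfileCalculus

/-!
# `ContinuousAlignmentCriterion` is false without the Leray–Hopf (finite-energy) hypothesis

Negative-side support for crux `ContinuousAlignmentCriterion` (stmt-NavierStokesRegularity-18584, route
`ContinuousAlignment`, W2 = the rate-free Constantin–Fefferman criterion), refuter crux-attack 2026-08-17.

LOAD-BEARING ANALYSIS. The statement negated in `continuousAlignmentCriterion_false_without_lerayHopf` is the
crux with the hypothesis `IsLerayHopfOn T ν 0 (u 0) u` deleted (classical solution on `[0,T)` from a rapidly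
decaying datum, uniformly continuous vorticity direction on `{|ω| > d}` ⇒ smooth extension past `T`). It is
FALSE: the pressure-driven spatially constant runaway
`u(t,x) = ((1−t)⁻¹ − 1) e₀`, `p(t,x) = −(1−t)⁻² ⟪e₀, x⟫` is an exact classical Navier–Stokes solution on
`[0,1) × ℝ³` (every viscosity) with ZERO datum and ZERO vorticity — so the alignment clause holds vacuously for
every threshold `d > 0` — yet `‖u(t,0)‖ → ∞` as `t ↑ 1`, so no classical solution on a longer interval agrees
with it on `[0,1)`. Hence any proof of W2 must use the finite-energy / Leray–Hopf class (which excludes this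
witness: `u(t) ∉ L²` for `t > 0`). The witness is the accelerated-frame image of the rest state (extended Galilean
covariance, cf. `IsClassicalNSSolutionOn.galileanBoost`), written out directly because the frame is singular at
`t = 1`. [folklore]
-/

noncomputable section

namespace Summit.NavierStokesRegularity.NavierStokesRegularity.Theorems.ContinuousAlignmentCriterion.Negative

open scoped InnerProductSpace RealInnerProductSpace Laplacian ContDiff Topology
open Literature.Analysis.FluidPDE Set Function

/-- Physical space `ℝ³`. -/
abbrev E3 := EuclideanSpace ℝ (Fin 3)

/-! ## The witness: a pressure-driven spatially constant runaway -/

/-- The runaway direction `e₀`. -/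
def e0 : E3 := EuclideanSpace.single 0 1

/-- The amplitude `a(t) = (1 − t)⁻¹ − 1` (`a(0) = 0`, `a(t) ↑ ∞` as `t ↑ 1`). -/
def amp (t : ℝ) : ℝ := (1 - t)⁻¹ - 1

/-- The velocity `u(t, x) = a(t) e₀` (constant in space). -/
def uW (t : ℝ) (_x : E3) : E3 := amp t • e0

/-- The pressure `p(t, x) = ⟪−(1−t)⁻² e₀, x⟫` (so that `−∇p = a'(t) e₀`). -/
def pW (t : ℝ) (x : E3) : ℝ := ⟪-(((1 - t) ^ 2)⁻¹ • e0), x⟫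

/-- The gradient of the linear functional `x ↦ ⟪c, x⟫` is `c`. [folklore] -/
theorem gradient_inner_const_left' (c x : E3) : gradient (fun y => ⟪c, y⟫) x = c := by
  have h : HasFDerivAt (fun y => ⟪c, y⟫) (innerSL ℝ c) x := (innerSL ℝ c).hasFDerivAt
  rw [gradient, h.fderiv]
  apply (InnerProductSpace.toDual ℝ E3).injective
  rw [LinearIsometryEquiv.apply_symm_apply]
  ext y
  simp [InnerProductSpace.toDual_apply_apply]

/-- `curl` of a spatially constant field vanishes. [folklore] -/
theorem curl_const (c x : E3) : curl (fun _ : E3 => c) x = 0 := by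
  unfold curl
  simp

/-- The amplitude has derivative `(1 − t)⁻²` at every `t ≠ 1`. -/
theorem hasDerivAt_amp {t : ℝ} (ht : t ≠ 1) : HasDerivAt amp (((1 - t) ^ 2)⁻¹) t := by
  have h1 : HasDerivAt (fun s : ℝ => 1 - s) (-1) t := (hasDerivAt_id t).const_sub 1
  have hne : (1 - t) ≠ 0 := sub_ne_zero.2 (Ne.symm ht)
  have h2 := (h1.inv hne).sub_const 1
  rw [neg_neg, one_div] at h2
  exact h2

/-- **The runaway is an exact classical Navier–Stokes solution on `[0,1) × ℝ³`** (every viscosity, zero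
force): `∂ₜu = a'(t)e₀ = −∇p`, `(u·∇)u = 0`, `Δu = 0`, `div u = 0`. [folklore] -/
theorem isClassicalNSSolutionOn_uW (ν : ℝ) : IsClassicalNSSolutionOn (Ico 0 1) ν 0 uW pW where
  smooth_velocity := by
    unfold IsSmoothSpaceTimeOn
    have hne : ∀ z ∈ (Ico (0 : ℝ) 1 ×ˢ (univ : Set E3)), (1 : ℝ) - z.1 ≠ 0 := by
      rintro ⟨t, x⟩ hz
      have ht : t < 1 := (mem_prod.1 hz).1.2
      exact sub_ne_zero.2 (ne_of_gt ht)
    have hamp : ContDiffOn ℝ ∞ (fun z : ℝ × E3 => amp z.1) (Ico (0 : ℝ) 1 ×ˢ univ) := by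
      unfold amp
      exact ((contDiffOn_const.sub contDiffOn_fst).inv hne).sub contDiffOn_const
    have heq : uncurry uW = fun z : ℝ × E3 => amp z.1 • e0 := by
      funext z; rfl
    rw [heq]
    exact hamp.smul contDiffOn_const
  smooth_pressure := by
    unfold IsSmoothSpaceTimeOn
    have hne : ∀ z ∈ (Ico (0 : ℝ) 1 ×ˢ (univ : Set E3)), (1 : ℝ) - z.1 ≠ 0 := by
      rintro ⟨t, x⟩ hz
      have ht : t < 1 := (mem_prod.1 hz).1.2
      exact sub_ne_zero.2 (ne_of_gt ht)
    have hc : ContDiffOn ℝ ∞ (fun z : ℝ × E3 => -(((1 - z.1) ^ 2)⁻¹ • e0)) (Ico (0 : ℝ) 1 ×ˢ univ) :=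
      ((((contDiffOn_const.sub contDiffOn_fst).pow 2).inv (fun z hz => pow_ne_zero 2 (hne z hz))).smul
        contDiffOn_const).neg
    have heq : uncurry pW = fun z : ℝ × E3 => ⟪-(((1 - z.1) ^ 2)⁻¹ • e0), z.2⟫ := by
      funext z; rfl
    rw [heq]
    exact hc.inner ℝ contDiffOn_snd
  momentum t ht x := by
    have ht1 : t ≠ 1 := ne_of_lt ht.2
    -- time derivative
    have hT : timeDerivWithin (Ico 0 1) uW t x = ((1 - t) ^ 2)⁻¹ • e0 := by
      rw [timeDerivWithin_apply]
      have h := ((hasDerivAt_amp ht1).smul_const e0).hasDerivWithinAt (s := Ico (0 : ℝ) 1)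
      exact h.derivWithin (uniqueDiffOn_Ico 0 1 t ht)
    -- convective term
    have hC : convect (uW t) (uW t) x = 0 := by
      show fderiv ℝ (fun _ : E3 => amp t • e0) x (uW t x) = 0
      simp
    -- Laplacian
    have hL : (Δ (uW t)) x = 0 := laplacian_const_eq_zero (amp t • e0) x
    -- pressure gradient
    have hG : gradient (pW t) x = -(((1 - t) ^ 2)⁻¹ • e0) :=
      gradient_inner_const_left' _ x
    rw [hT, hC, hG]
    change ((1 - t) ^ 2)⁻¹ • e0 + 0 = ν • (Δ (uW t)) x - -(((1 - t) ^ 2)⁻¹ • e0) + 0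
    rw [hL]
    simp
  divFree t _ x := by
    show LinearMap.trace ℝ E3 ((fderiv ℝ (fun _ : E3 => amp t • e0) x : E3 →L[ℝ] E3) : E3 →ₗ[ℝ] E3) = 0
    simp

/-- The datum of the runaway is zero, hence rapidly decaying. -/
theorem uW_zero : uW 0 = 0 := by
  funext x
  simp [uW, amp]

/-- The zero datum decays rapidly. [folklore] -/
theorem hasRapidSpatialDecay_uW_zero : HasRapidSpatialDecay (uW 0) := by
  rw [uW_zero]
  intro n K
  refine ⟨0, fun x => ?_⟩
  have : iteratedFDeriv ℝ n (0 : E3 → E3) x = 0 := by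
    rw [Pi.zero_def, iteratedFDeriv_fun_zero]; rfl
  rw [this, norm_zero, mul_zero]

/-- The runaway is irrotational: `curl u(t) ≡ 0`. -/
theorem curl_uW (t : ℝ) (x : E3) : curl (uW t) x = 0 :=
  curl_const (amp t • e0) x

/-- **The runaway admits no classical continuation past `t = 1`**: a classical `u'` on `[0, T')`, `T' > 1`,
agreeing with `u` on `[0,1)` would be continuous, hence bounded, on the compact segment `[0,1] × {0}`, while
`‖u(t, 0)‖ = (1−t)⁻¹ − 1 → ∞`. [folklore] -/
theorem not_hasSmoothExtensionPast_uW (ν : ℝ) : ¬ HasSmoothExtensionPast ν 0 uW 1 := by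
  rintro ⟨T', hT', u', p', hcl, hagree⟩
  have hcont : ContinuousOn (uncurry u') (Ico (0 : ℝ) T' ×ˢ (univ : Set E3)) :=
    hcl.smooth_velocity.continuousOn
  have hK : IsCompact (Icc (0 : ℝ) 1 ×ˢ ({0} : Set E3)) := isCompact_Icc.prod isCompact_singleton
  have hsub : Icc (0 : ℝ) 1 ×ˢ ({0} : Set E3) ⊆ Ico (0 : ℝ) T' ×ˢ (univ : Set E3) :=
    prod_mono (Icc_subset_Ico_right hT') (subset_univ _)
  obtain ⟨M, hM⟩ := hK.exists_bound_of_continuousOn (hcont.mono hsub)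
  have hM0 : 0 ≤ M := le_trans (norm_nonneg _) (hM (0, 0) (mk_mem_prod ⟨le_rfl, zero_le_one⟩ rfl))
  -- the time t = 1 - 1/(M+2) ∈ [0,1) where ‖u(t,0)‖ = M + 1
  set t : ℝ := 1 - (M + 2)⁻¹ with htdef
  have hM2 : 0 < M + 2 := by linarith
  have ht0 : 0 ≤ t := by
    rw [htdef, sub_nonneg]
    exact inv_le_one_of_one_le₀ (by linarith)
  have ht1 : t < 1 := by
    rw [htdef, sub_lt_self_iff]
    exact inv_pos.2 hM2
  have hval : ‖uncurry u' (t, 0)‖ = M + 1 := by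
    have h1 : uncurry u' (t, 0) = uW t 0 := by
      simp only [uncurry_apply_pair]
      rw [hagree t ⟨ht0, ht1⟩]
    rw [h1]
    have he0 : ‖e0‖ = 1 := by simp [e0]
    simp only [uW, amp, norm_smul, he0, mul_one, Real.norm_eq_abs]
    rw [htdef]
    have : (1 - (1 - (M + 2)⁻¹))⁻¹ - 1 = M + 1 := by
      rw [sub_sub_cancel, inv_inv]; ring
    rw [this]
    exact abs_of_nonneg (by linarith)
  have hle := hM (t, 0) (mk_mem_prod ⟨ht0, ht1.le⟩ rfl)
  rw [hval] at hle
  linarith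

/-- **`ContinuousAlignmentCriterion` is FALSE without the Leray–Hopf hypothesis.** The negated statement is
the crux `Summit.NavierStokesRegularity.NavierStokesRegularity.Theses.ContinuousAlignment.ContinuousAlignmentCriterion`
with the single hypothesis `IsLerayHopfOn T ν 0 (u 0) u` deleted and everything else verbatim; hence any proof
of the crux must use the finite-energy class of the solution. Witness: `ν = 1`, `T = 1`, the runaway
`(uW, pW)`, threshold `d = 1` (the alignment clause is vacuous since `curl uW ≡ 0`). [folklore] -/
theorem continuousAlignmentCriterion_false_without_lerayHopf :
    ¬ (∀ (ν T : ℝ), 0 < ν → 0 < T → ∀ (u : ℝ → E3 → E3) (p : ℝ → E3 → ℝ),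
        IsClassicalNSSolutionOn (Set.Ico 0 T) ν 0 u p → HasRapidSpatialDecay (u 0) →
        ∀ d : ℝ, 0 < d → (∀ ε : ℝ, 0 < ε → ∃ δ : ℝ, 0 < δ ∧ ∀ t ∈ Set.Ico 0 T, ∀ x y : E3,
          d < ‖curl (u t) x‖ → d < ‖curl (u t) y‖ → ‖x - y‖ < δ →
          Real.sqrt (1 - (inner ℝ (‖curl (u t) x‖⁻¹ • curl (u t) x)
            (‖curl (u t) y‖⁻¹ • curl (u t) y)) ^ 2) ≤ ε) →
        HasSmoothExtensionPast ν 0 u T) := by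
  intro h
  refine not_hasSmoothExtensionPast_uW 1 (h 1 1 one_pos one_pos uW pW (isClassicalNSSolutionOn_uW 1)
    hasRapidSpatialDecay_uW_zero 1 one_pos ?_)
  intro ε hε
  refine ⟨1, one_pos, fun t _ x y hx _ _ => ?_⟩
  rw [curl_uW, norm_zero] at hx
  exact absurd hx (by norm_num)

-- Sanity check of the mutation (not a declaration): re-inserting the Leray–Hopf hypothesis (as an ignored
-- binder) into the statement negated above gives back the crux VERBATIM — this `example` type-checks only if
-- every other clause of the inline statement agrees with the route decl symbol by symbol.
example
    (h : ∀ (ν T : ℝ), 0 < ν → 0 < T → ∀ (u : ℝ → E3 → E3) (p : ℝ → E3 → ℝ),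
        IsClassicalNSSolutionOn (Set.Ico 0 T) ν 0 u p → HasRapidSpatialDecay (u 0) →
        ∀ d : ℝ, 0 < d → (∀ ε : ℝ, 0 < ε → ∃ δ : ℝ, 0 < δ ∧ ∀ t ∈ Set.Ico 0 T, ∀ x y : E3,
          d < ‖curl (u t) x‖ → d < ‖curl (u t) y‖ → ‖x - y‖ < δ →
          Real.sqrt (1 - (inner ℝ (‖curl (u t) x‖⁻¹ • curl (u t) x)
            (‖curl (u t) y‖⁻¹ • curl (u t) y)) ^ 2) ≤ ε) →
        HasSmoothExtensionPast ν 0 u T) :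
    Summit.NavierStokesRegularity.NavierStokesRegularity.Theses.ContinuousAlignment.ContinuousAlignmentCriterion :=
  fun ν T hν hT u p hcl _ hdec d hd hal => h ν T hν hT u p hcl hdec d hd hal

end Summit.NavierStokesRegularity.NavierStokesRegularity.Theorems.ContinuousAlignmentCriterion.Negative

end
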